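import Literature.NumberTheory.LFunctions.WeilExplicit
import Summits.RiemannHypothesis.RiemannHypothesis.Theorems.SuzukiWindowThetaFlow

/-!
# SuzukiThetaFlow — definitions: the `θ`-flow identity (T0) of the crux idea `theta-flow-weil-window`, typed, and its
reduction to ONE pairing identity (column DBR; RH-FREE; defs + one reduction)

RH-FREE throughout; nothing here bears on the truth of RH.  The residual `Theses.SuzukiWindowsDoor.AllWindowsWitness`
(stmt-19733) is RH-EQUIVALENT·DERIVED and is NOT asserted; the `∀ t` level of θ-antitone window norms is Weil's
criterion re-indexed (declared by the card, not claimed).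

The cell's crux idea `theta-flow-weil-window` (rh-dbr-idea-2 g2, HOME/rh-dbr-idea-2/g2-Sketch.lean; tautology test
PASSED, theory g7 10:44Z «T0/T1/T2 bank-worthy», TARGET-v7 §K.9 item 8) rests on the **θ-FLOW IDENTITY (T0)**
`d/dθ ‖𝖪_θ[t] f‖² = −2·Re weilQuadratic(g_θ)`, `g_θ = 𝖪_θ[t]f · 𝟙_{(−t,t)}`.  The tree now has its analytic half:
`Theorems.SuzukiWindowThetaFlow.hasDerivAt_winNormSq` — `d/dθ ‖𝖪_θ[t] f‖² = 2⟨𝖪_θ[t]f, 𝒥_θ[t]f⟩` with the flow kernel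
`J_θ = ∂_θ K_θ = Re (2π)⁻¹∫_{Im z = 1} L Θ_θ e^{−izx}`, `L = −2ξ'/ξ(½ − i·)` (`Theorems.SuzukiKernelThetaDeriv`).  This file
TYPES the objects of the card VERBATIM (`winMeasure`, `winOp`, `winNormSq`, `winOut`, `ThetaFlowIdentity`), names the flow
kernel (`flowKernel`) and the ONE remaining identity (`FlowPairing t`: `2⟨𝖪_θ[t]f, 𝒥_θ[t]f⟩ = −2·Re Q(g_θ)` — the
explicit-formula bookkeeping `⟨(k + k̃) ∗ g, g⟩ = −2·W(g ⋆ g̃)` in the tree's normalisation of `weilFunctional`), and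
PROVES the reduction `thetaFlowIdentity_of_flowPairing : FlowPairing t → ThetaFlowIdentity t`.

References: [Su20] M. Suzuki, ASPM 84 (2020) = arXiv:1907.07302, (1.4), (1.9); A. Weil (1952) / E. Bombieri, Rend.
Lincei (9) 11 (2000), Thm 2 (the tree's `weilFunctional`, `weilQuadratic`).
-/

noncomputable section

-- D-0017: `Summit.<S>.<S>.…` is the designed namespace of a single-problem summit.
set_option linter.dupNamespace false

open Complex MeasureTheory Set

namespace Summit.RiemannHypothesis.RiemannHypothesis.Theorems.SuzukiThetaFlow

open Literature.NumberTheory.LFunctions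
open Summit.RiemannHypothesis.RiemannHypothesis.Theorems.SuzukiKernelSemigroup

/-! ## The objects of the card (verbatim `rh-dbr-idea-2/g2-Sketch.lean`) -/

/-- RH-FREE (definition, idea-2 verbatim). `L²`-data live on the window measure `vol|(−t,t)` (as in `NoUnitEigenvalue`). -/
def winMeasure (t : ℝ) : Measure ℝ := volume.restrict (Ioo (-t) t)

/-- RH-FREE (definition, idea-2 verbatim). `(𝖪[t] f)(x) = ∫_{(−t,t)} K(x+y) f(y) dy` — the integrand of
`NoUnitEigenvalue K t` ([Su20] (1.4)). -/
def winOp (K : ℝ → ℝ) (t : ℝ) (f : ℝ → ℝ) (x : ℝ) : ℝ :=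
  ∫ y in Ioo (-t) t, K (x + y) * f y

/-- RH-FREE (definition, idea-2 verbatim). `‖𝖪[t] f‖²_{L²(−t,t)}`. -/
def winNormSq (K : ℝ → ℝ) (t : ℝ) (f : ℝ → ℝ) : ℝ :=
  ∫ x in Ioo (-t) t, (winOp K t f x) ^ 2

/-- RH-FREE (definition, idea-2 verbatim). The output `g_θ = 𝖪_θ[t] f`, extended by zero and read as a complex
function (the argument of Weil's quadratic functional in the θ-flow identity). -/
def winOut (θ t : ℝ) (f : ℝ → ℝ) : ℝ → ℂ :=
  fun x => (((Ioo (-t) t).indicator (winOp (limKernel θ) t f)) x : ℂ)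

/-- RH-FREE (definition, idea-2 verbatim). **(T0) θ-FLOW IDENTITY**: for `θ > 1` the squared window norm is
differentiable in `θ` with derivative `−2·Re Q(g_θ)`, `Q = weilQuadratic` (tree normalisation
`W = weilPolarTerm − weilPrimeTerm + weilArchTerm`). -/
def ThetaFlowIdentity (t : ℝ) : Prop :=
  ∀ θ : ℝ, 1 < θ → ∀ f : ℝ → ℝ, MemLp f 2 (winMeasure t) →
    HasDerivAt (fun θ' : ℝ => winNormSq (limKernel θ') t f)
      (-2 * (weilQuadratic (winOut θ t f)).re) θ

/-! ## The flow kernel and the remaining pairing identity -/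

/-- RH-FREE (definition). The FLOW KERNEL `J_θ(x) = ∂_θ K_θ(x) = Re (2π)⁻¹ ∫_{Im z = 1} L(z) Θ_θ(z) e^{−izx} dz`,
`L(z) = −2 ξ'/ξ(½ − iz)` (`Theorems.SuzukiKernelThetaDeriv.hasDerivAt_limKernel`; formally `J_θ = k ∗ K_θ` with `k̂ = L`). -/
def flowKernel (θ : ℝ) (x : ℝ) : ℝ :=
  (invFourierLine (fun z : ℂ => -2 * logDeriv riemannXi (1 / 2 - I * z) * limTheta θ z) 1 x).re

/-- RH-FREE (definition). **THE REMAINING IDENTITY of (T0)** — the explicit-formula pairing on the window: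
for `θ > 1` and `f ∈ L²(−t,t)`, `2⟨𝖪_θ[t]f, 𝒥_θ[t]f⟩_{L²(−t,t)} = −2·Re weilQuadratic(g_θ)`, `g_θ = winOut θ t f`,
`𝒥_θ[t] = winOp (flowKernel θ) t`.  (Content: `J_θ = k ∗ K_θ` with `k` the causal explicit-formula distribution
`2ΣΛ(n)n^{-1/2}δ_{log n} − 4cosh(x/2)𝟙_{x>0} + (archimedean part)`, causality `(𝖪_θ f)(x') = 0` for `x' ≤ −t`, and
`⟨(k + k̃) ∗ g, g⟩ = −2·weilFunctional(g ⋆ g̃)` term by term in the tree's normalisation; rh-dbr-idea-2 MEMO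
`g2-MEMO-theta-flow.md`.)  Not proved here. -/
def FlowPairing (t : ℝ) : Prop :=
  ∀ θ : ℝ, 1 < θ → ∀ f : ℝ → ℝ, MemLp f 2 (winMeasure t) →
    ∫ x in Ioo (-t) t, 2 * winOp (limKernel θ) t f x * winOp (flowKernel θ) t f x =
      -2 * (weilQuadratic (winOut θ t f)).re

/-- **RH-FREE · (T0) reduces to the pairing identity**: `FlowPairing t → ThetaFlowIdentity t`
(the analytic half `d/dθ ‖𝖪_θ[t] f‖² = 2⟨𝖪_θ[t]f, 𝒥_θ[t]f⟩` is `SuzukiKernelSemigroup.hasDerivAt_winNormSq`;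
`L² ⊂ L¹` on the finite window).  Nothing here bears on RH. -/
theorem thetaFlowIdentity_of_flowPairing {t : ℝ} (h : FlowPairing t) : ThetaFlowIdentity t := by
  intro θ hθ f hf
  have hfi : Integrable f (volume.restrict (Ioo (-t) t)) := by
    haveI : IsFiniteMeasure (winMeasure t) := by unfold winMeasure; infer_instance
    exact hf.integrable one_le_two
  have hd := hasDerivAt_winNormSq hθ hfi
  rw [← h θ hθ f hf]
  exact hd

end Summit.RiemannHypothesis.RiemannHypothesis.Theorems.SuzukiThetaFlow

end
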